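import Summits.HubbardSuperconductivity.HubbardSuperconductivity.Theorems.AnisotropyChordStiffnessContinuity
import Literature.MathematicalPhysics.QuantumLattice.FinDimSpectrumSectorGibbsLimit
import Literature.MathematicalPhysics.QuantumLattice.LTQOProofs
import Literature.MathematicalPhysics.QuantumLattice.HeisenbergModelGlobalRotationProofs
import Summits.HubbardSuperconductivity.HubbardSuperconductivity.Theorems.AnisotropyChordEnergyConvexOfLogConcave

/-!
# Route `AnisotropyChord` / H0 rotor rung: SECTOR VANISHING, the TWIST JUMP and the helicity-tensor re-cut of
# T-DEFICIT (theory seat memo ROTOR-THEORY-8 §119; Sketch8 Part O ported), with the exact stubs DISCHARGED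

* `sectorVanishing` (PROVED): an eigenvector of `H(Δ)` below the sector energy is orthogonal to the sector;
* `bondCurrent_commute_totalSpin`, `currentMode_mulVec_mem_spinZSector`; `currentAmp`;
* **T-JUMP `twistJump` (PROVED)**;
* typed: `UniformHelicityTensor` (S_Υ, hypothesis of H0), `KLipschitzDeficit` (pure locality; the ONE remaining
  analytic stub of THEOREM TWIST-IR); (`ContinuityEquation` is in `AnisotropyChordStiffnessContinuity`, proved there);
* compositions (PROVED): `filteredCurrentDeficit_of_helicity`, `eventualCondensate_of_helicity_skeleton`, and with
  T-FSUM (`latticeFSumRule_holds`) and D1 (`continuityEquation_holds`) discharged: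
  **`eventualCondensate_of_kLipschitz`: `KLipschitzDeficit ∧ H1′ ∧ (S_Υ) ∧ (S ≤ S_max) ⇒ BEC`** along every
  density sequence — H0 in the rotor class modulo ONE locality theorem and the physics hypotheses.
Typing authority: theory seat `hubbard-h0-rotor-theory-1`, cycle 8.
-/

set_option linter.dupNamespace false

noncomputable section

open Matrix Complex Finset Filter Topology
open scoped ComplexConjugate
open Literature.MathematicalPhysics.QuantumLattice hiding torusPhase torusNorm
open Literature.Probability.LatticeModels
open Summit.HubbardSuperconductivity.HubbardSuperconductivity.Theorems.AnisotropyChord.InsertionEntropy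
open Summit.HubbardSuperconductivity.HubbardSuperconductivity.Theorems.AnisotropyChord (xxz_mulVec_mem_weightSector)

namespace Summit.HubbardSuperconductivity.HubbardSuperconductivity.Theorems.AnisotropyChord.Stiffness

/-- `H(Δ)` preserves every magnetisation sector (any real label `M`; an empty sector is `⊥`). [folklore] -/
theorem hcb_mulVec_mem_spinZSector (L : ℕ) [NeZero L] (Δ M : ℝ)
    {v : TensorIndex (TorusSite 2 L) 2 → ℂ} (hv : v ∈ spinZSector (Λ := TorusSite 2 L) 1 M) :
    hcbHamiltonian L Δ *ᵥ v ∈ spinZSector (Λ := TorusSite 2 L) 1 M := by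
  by_cases hbot : spinZSector (Λ := TorusSite 2 L) 1 M = ⊥
  · rw [hbot, Submodule.mem_bot] at hv
    rw [hbot, hv, mulVec_zero]
    exact Submodule.zero_mem _
  · obtain ⟨σ, hσ⟩ := (spinZSector_ne_bot_iff 1 M).1 hbot
    have hM : M = ((Fintype.card (TorusSite 2 L) * 1 : ℕ) : ℝ) / 2 - ((∑ x, (σ x : ℕ) : ℕ) : ℝ) := by
      rw [← hσ]
      unfold mag
      rw [Finset.sum_sub_distrib, Finset.sum_const, Finset.card_univ, nsmul_eq_mul]
      push_cast
      ring
    rw [hM] at hv ⊢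
    exact xxz_mulVec_mem_weightSector (torusGraph 2 L) Δ _ hv

/-- **SECTOR VANISHING (PROVED).** An eigenvector `vᵢ` of `H(Δ)` with eigenvalue strictly below the
sector energy `E₀(M)` is orthogonal to the whole sector `M` (`P_K vᵢ = 0` by the tree's
`projMatrix_map_mulVec_eigenvector_below_eq_zero`, `P_K` Hermitian and `P_K w = w`).  This is the one
place where the sector structure enters T-DEFICIT: the spectral sums over the FULL eigenbasis carry
no weight at negative excitation energy. [folklore] -/
theorem sectorVanishing (L : ℕ) [NeZero L] (Δ M : ℝ) {w : TensorIndex (TorusSite 2 L) 2 → ℂ}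
    (hw : w ∈ spinZSector (Λ := TorusSite 2 L) 1 M) (i : TensorIndex (TorusSite 2 L) 2)
    (hlt : excitation L Δ M i < 0) :
    star (⇑((hcbHamiltonian_isHermitian L Δ).eigenvectorBasis i)) ⬝ᵥ w = 0 := by
  have hinv : ∀ v ∈ spinZSector (Λ := TorusSite 2 L) 1 M,
      hcbHamiltonian L Δ *ᵥ v ∈ spinZSector (Λ := TorusSite 2 L) 1 M :=
    fun v hv => hcb_mulVec_mem_spinZSector L Δ M hv
  have hu : hcbHamiltonian L Δ *ᵥ ⇑((hcbHamiltonian_isHermitian L Δ).eigenvectorBasis i)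
      = (((hcbHamiltonian_isHermitian L Δ).eigenvalues i : ℝ) : ℂ)
          • ⇑((hcbHamiltonian_isHermitian L Δ).eigenvectorBasis i) := by
    rw [(hcbHamiltonian_isHermitian L Δ).mulVec_eigenvectorBasis i]
    funext σ
    simp only [Pi.smul_apply, Complex.real_smul, smul_eq_mul]
  have hμ : (hcbHamiltonian_isHermitian L Δ).eigenvalues i
      < (hcbHamiltonian L Δ).minEnergyOn (spinZSector (Λ := TorusSite 2 L) 1 M) := by
    have h := hlt
    unfold excitation lowestEnergyInSector at h
    linarith
  have hP := projMatrix_map_mulVec_eigenvector_below_eq_zero (hcbHamiltonian_isHermitian L Δ)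
    (spinZSector (Λ := TorusSite 2 L) 1 M) hinv hu hμ
  have hPw := projMatrix_map_mulVec_of_mem (spinZSector (Λ := TorusSite 2 L) 1 M) hw
  set P := projMatrix ((spinZSector (Λ := TorusSite 2 L) 1 M).map
    ((WithLp.linearEquiv 2 ℂ (TensorIndex (TorusSite 2 L) 2 → ℂ)).symm :
      (TensorIndex (TorusSite 2 L) 2 → ℂ) →ₗ[ℂ] EuclideanSpace ℂ (TensorIndex (TorusSite 2 L) 2)))
    with hPdef
  calc star (⇑((hcbHamiltonian_isHermitian L Δ).eigenvectorBasis i)) ⬝ᵥ w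
      = star (⇑((hcbHamiltonian_isHermitian L Δ).eigenvectorBasis i)) ⬝ᵥ (P *ᵥ w) := by rw [hPw]
    _ = star (Pᴴ *ᵥ ⇑((hcbHamiltonian_isHermitian L Δ).eigenvectorBasis i)) ⬝ᵥ w := by
        rw [star_mulVec, conjTranspose_conjTranspose, dotProduct_mulVec]
    _ = 0 := by rw [(projMatrix_isHermitian _).eq, hP, star_zero, zero_dotProduct]

/-- `[j_{xy}, Sᶻ_tot] = 0`: the bond current conserves the particle number (`[Sˣ_xSʸ_y − Sʸ_xSˣ_y, Sᶻ_tot]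
= i(SˣSˣ − SʸSʸ) − i(SˣSˣ − SʸSʸ) = 0`). [folklore] -/
theorem bondCurrent_commute_totalSpin (L : ℕ) [NeZero L] (x y : TorusSite 2 L) :
    Commute (bondCurrent L x y) (totalSpin (Λ := TorusSite 2 L) 1 2) := by
  have e1 : (2 : Fin 3) + 1 = 0 := by decide
  have e2 : (2 : Fin 3) + 2 = 1 := by decide
  have e3 : (1 : Fin 3) + 1 = 2 := by decide
  have e4 : (1 : Fin 3) + 2 = 0 := by decide
  have hA : ∀ z : TorusSite 2 L, (siteSpin 1 z 0 * totalSpin 1 2 - totalSpin 1 2 * siteSpin 1 z 0 :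
      Op (TorusSite 2 L) 2) = -(Complex.I • siteSpin 1 z 1) := by
    intro z
    have hc : ⁅spinVec 1 2, spinVec 1 (2 + 1)⁆ = Complex.I • spinVec 1 (2 + 2) :=
      spin_commutation_holds 1 2
    rw [e1, e2] at hc
    have hc' : ⁅spinVec 1 0, spinVec 1 2⁆ = -(Complex.I • spinVec 1 1) := by
      rw [← hc, Ring.lie_def, Ring.lie_def, neg_sub]
    rw [siteSpin_mul_totalSpin_sub, hc', onSite_neg', onSite_smul']
    rfl
  have hB : ∀ z : TorusSite 2 L, (siteSpin 1 z 1 * totalSpin 1 2 - totalSpin 1 2 * siteSpin 1 z 1 :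
      Op (TorusSite 2 L) 2) = Complex.I • siteSpin 1 z 0 := by
    intro z
    have hc : ⁅spinVec 1 1, spinVec 1 (1 + 1)⁆ = Complex.I • spinVec 1 (1 + 2) :=
      spin_commutation_holds 1 1
    rw [e3, e4] at hc
    rw [siteSpin_mul_totalSpin_sub, hc, onSite_smul']
    rfl
  have key : (siteSpin 1 x 0 * siteSpin 1 y 1 - siteSpin 1 x 1 * siteSpin 1 y 0 : Op (TorusSite 2 L) 2)
        * totalSpin 1 2
      - totalSpin 1 2 * (siteSpin 1 x 0 * siteSpin 1 y 1 - siteSpin 1 x 1 * siteSpin 1 y 0)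
      = siteSpin 1 x 0 * (siteSpin 1 y 1 * totalSpin 1 2 - totalSpin 1 2 * siteSpin 1 y 1)
        + (siteSpin 1 x 0 * totalSpin 1 2 - totalSpin 1 2 * siteSpin 1 x 0) * siteSpin 1 y 1
        - (siteSpin 1 x 1 * (siteSpin 1 y 0 * totalSpin 1 2 - totalSpin 1 2 * siteSpin 1 y 0)
          + (siteSpin 1 x 1 * totalSpin 1 2 - totalSpin 1 2 * siteSpin 1 x 1) * siteSpin 1 y 0) := by
    noncomm_ring
  rw [hB y, hA x, hA y, hB x] at key
  have h0 : (siteSpin 1 x 0 * siteSpin 1 y 1 - siteSpin 1 x 1 * siteSpin 1 y 0 : Op (TorusSite 2 L) 2)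
        * totalSpin 1 2
      = totalSpin 1 2 * (siteSpin 1 x 0 * siteSpin 1 y 1 - siteSpin 1 x 1 * siteSpin 1 y 0) := by
    rw [← sub_eq_zero, key]
    simp only [mul_smul_comm, smul_mul_assoc, mul_neg, neg_mul]
    abel
  unfold bondCurrent
  exact Commute.smul_left h0 _

/-- The current modes conserve the particle number. [folklore] -/
theorem currentMode_commute_totalSpin (L : ℕ) [NeZero L] (k : TorusSite 2 L) (j : Fin 2) :
    Commute (currentMode L k j) (totalSpin (Λ := TorusSite 2 L) 1 2) := by
  unfold currentMode
  exact Commute.sum_left _ _ _ fun x _ => (bondCurrent_commute_totalSpin L x _).smul_left _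

/-- The current modes preserve every magnetisation sector. [folklore] -/
theorem currentMode_mulVec_mem_spinZSector (L : ℕ) [NeZero L] (k : TorusSite 2 L) (j : Fin 2) (M : ℝ)
    {v : TensorIndex (TorusSite 2 L) 2 → ℂ} (hv : v ∈ spinZSector (Λ := TorusSite 2 L) 1 M) :
    currentMode L k j *ᵥ v ∈ spinZSector (Λ := TorusSite 2 L) 1 M := by
  unfold spinZSector at hv ⊢
  exact mulVec_mem_eigenspace_of_commute (currentMode_commute_totalSpin L k j) hv

/-- The CURRENT AMPLITUDE `⟨vᵢ, J^j_k ψ⟩` of the eigenvector `vᵢ` of `H(Δ)` (state `ψ = a`). [folklore] -/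
def currentAmp (L : ℕ) [NeZero L] (Δ : ℝ) (a : TensorIndex (TorusSite 2 L) 2 → ℝ) (k : TorusSite 2 L)
    (j : Fin 2) (i : TensorIndex (TorusSite 2 L) 2) : ℂ :=
  star (⇑((hcbHamiltonian_isHermitian L Δ).eigenvectorBasis i)) ⬝ᵥ (currentMode L k j *ᵥ toC L a)

/-- `Σ_j ε_j ⟨vᵢ, Jʲ_k ψ⟩ = ⟨vᵢ, (Σ_j ε_j Jʲ_k) ψ⟩`. [folklore] -/
theorem sum_currentAmp_eq (L : ℕ) [NeZero L] (Δ : ℝ) (a : TensorIndex (TorusSite 2 L) 2 → ℝ)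
    (k : TorusSite 2 L) (ε : Fin 2 → ℂ) (i : TensorIndex (TorusSite 2 L) 2) :
    ∑ j, ε j * currentAmp L Δ a k j i
      = star (⇑((hcbHamiltonian_isHermitian L Δ).eigenvectorBasis i))
          ⬝ᵥ (∑ j, ε j • (currentMode L k j *ᵥ toC L a)) := by
  unfold currentAmp
  rw [dotProduct_sum]
  refine Finset.sum_congr rfl fun j _ => ?_
  rw [dotProduct_smul, smul_eq_mul]

/-- `(Σ c_j A_j) v = Σ c_j (A_j v)`. [folklore] -/
theorem sum_smul_mulVec {ι : Type*} (s : Finset ι) {m : Type*} [Fintype m] (c : ι → ℂ)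
    (A : ι → Matrix m m ℂ) (v : m → ℂ) :
    (∑ j ∈ s, c j • A j) *ᵥ v = ∑ j ∈ s, c j • (A j *ᵥ v) := by
  classical
  induction s using Finset.induction_on with
  | empty => simp
  | insert a s ha ih => rw [Finset.sum_insert ha, Finset.sum_insert ha, add_mulVec, smul_mulVec, ih]

/-- `g_Ω(ω) ≤ 1/ω` for `ω > 0`. [folklore] -/
theorem lorentzFilter_le_inv {Ω ω : ℝ} (hω : 0 < ω) : lorentzFilter Ω ω ≤ 1 / ω := by
  unfold lorentzFilter
  rw [div_le_div_iff₀ (by positivity) hω]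
  nlinarith [sq_nonneg Ω, sq_nonneg ω]

/-- **T-JUMP (PROVED; memo §118 (D2), §119).**  If the SPECTRAL helicity form holds in the state `a`
(`2 Σᵢ |Σ_j ε_j ⟨vᵢ, J^j_0ψ⟩|²/ωᵢ ≤ Σ_j |ε_j|² B_j`), then for EVERY `Ω > 0` the Lorentz-filtered
`k = 0` current kernel obeys `Σᵢ g_Ω(ωᵢ)|Σ_j ε_j⟨vᵢ,J^j_0ψ⟩|² ≤ ½ Σ_j |ε_j|² B_j`:
`g_Ω(ω) ≤ 1/ω` for `ω > 0`, both sides vanish at `ω = 0`, and `ω < 0` carries no weight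
(`sectorVanishing`, the current modes preserving the sector). [folklore] -/
theorem twistJump (L : ℕ) [NeZero L] (Δ M : ℝ) (a : TensorIndex (TorusSite 2 L) 2 → ℝ)
    (ha : IsPerronSectorGroundAmplitude L Δ M a) (B : Fin 2 → ℝ) (ε : Fin 2 → ℂ)
    (hhel : 2 * ∑ i, ‖∑ j, ε j * currentAmp L Δ a 0 j i‖ ^ 2 / excitation L Δ M i
      ≤ ∑ j, ‖ε j‖ ^ 2 * B j)
    (Ω : ℝ) (_hΩ : 0 < Ω) :
    ∑ i, lorentzFilter Ω (excitation L Δ M i) * ‖∑ j, ε j * currentAmp L Δ a 0 j i‖ ^ 2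
      ≤ 1 / 2 * ∑ j, ‖ε j‖ ^ 2 * B j := by
  have hmem : (∑ j, ε j • (currentMode L 0 j *ᵥ toC L a)) ∈ spinZSector (Λ := TorusSite 2 L) 1 M :=
    Submodule.sum_mem _ fun j _ =>
      Submodule.smul_mem _ _ (currentMode_mulVec_mem_spinZSector L 0 j M ha.sector)
  have hterm : ∀ i, lorentzFilter Ω (excitation L Δ M i) * ‖∑ j, ε j * currentAmp L Δ a 0 j i‖ ^ 2
      ≤ ‖∑ j, ε j * currentAmp L Δ a 0 j i‖ ^ 2 / excitation L Δ M i := by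
    intro i
    rcases lt_trichotomy (excitation L Δ M i) 0 with hlt | heq | hgt
    · have h0 : ∑ j, ε j * currentAmp L Δ a 0 j i = 0 := by
        rw [sum_currentAmp_eq, sectorVanishing L Δ M hmem i hlt]
      rw [h0, norm_zero]
      simp
    · rw [heq]
      simp [lorentzFilter]
    · rw [div_eq_inv_mul, ← one_div]
      exact mul_le_mul_of_nonneg_right (lorentzFilter_le_inv hgt) (sq_nonneg _)
  calc ∑ i, lorentzFilter Ω (excitation L Δ M i) * ‖∑ j, ε j * currentAmp L Δ a 0 j i‖ ^ 2
      ≤ ∑ i, ‖∑ j, ε j * currentAmp L Δ a 0 j i‖ ^ 2 / excitation L Δ M i :=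
        Finset.sum_le_sum fun i _ => hterm i
    _ ≤ 1 / 2 * ∑ j, ‖ε j‖ ^ 2 * B j := by linarith

/-- **HYPOTHESIS (S_Υ) — `UniformHelicityTensor`** (uniform stiffness, SPECTRAL TENSOR form): there is
`Υ₀ > 0` such that, eventually in `L`, for the Perron reference amplitude of sector `M_L − 1` and every
`ε ∈ ℂ²`:  `2 Σᵢ |Σ_j ε_j ⟨vᵢ, J^j_0 ψ⟩|²/ωᵢ ≤ Σ_j |ε_j|² (⟨−T_j⟩ − Υ₀ L²)`, i.e. the helicity-modulus
MATRIX `Υ_{jj'} = (⟨−T_j⟩δ_{jj'} − 2K^{1/ω}_{jj'}(0))/L²` is `≥ Υ₀·1`.  This is the faithful rendering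
of «uniform (twist) stiffness in every direction»; it is implied by the variational `UniformTwistStiffness`
for both axes plus the reflection symmetry of the Perron state (memo §118 (D2)), and implies it by
Cauchy–Schwarz.  ED (j298465): `Υ_tw/t = 0.985–0.999` (diagonal), off-diagonal `= 0` by symmetry.
[conjecture: theory seat hubbard-h0-rotor-theory-1, cycle 8, 2026-08-28 — memo ROTOR-THEORY-8 §119; hypothesis of H0] -/
def UniformHelicityTensor (Δ : ℝ) (M : ℕ → ℝ) : Prop :=
  ∃ Υ₀ > (0 : ℝ), ∀ᶠ L : ℕ in atTop, ∀ [NeZero L],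
    ∀ a : TensorIndex (TorusSite 2 L) 2 → ℝ, IsPerronSectorGroundAmplitude L Δ (M L - 1) a →
      ∀ ε : Fin 2 → ℂ,
        2 * ∑ i, ‖∑ j, ε j * currentAmp L Δ a 0 j i‖ ^ 2 / excitation L Δ (M L - 1) i
          ≤ ∑ j, ‖ε j‖ ^ 2 * (kineticExpect L a j - Υ₀ * (L : ℝ) ^ 2)

/-- **STUB (D3–D5) — `KLipschitzDeficit Δ M`** (PURE LOCALITY; the analytic heart of THEOREM TWIST-IR,
memo §107 L2/L4, §116, §118 (D3)–(D5)): for every `η > 0` there are `γ ∈ (0,1]` and `C > 0` such that,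
eventually in `L`, for the Perron reference amplitude, every `k ≠ 0` and every `ε ∈ ℂ²`, the
`g_Ω`-filtered current kernel at `Ω = C|k|_T^γ` is `k`-Lipschitz up to `η L² |ε|²`:
`Σᵢ g_Ω(ωᵢ)|Σ_j ε_j⟨vᵢ,J^j_kψ⟩|² ≤ Σᵢ g_Ω(ωᵢ)|Σ_j ε_j⟨vᵢ,J^j_0ψ⟩|² + η L² Σ_j|ε_j|²`.
Small `|k|`: filtered locality (`filteredSpectral_identity_odd`) + Lieb–Robinson far field
(`‖w_Ω‖₁ = 1/Ω`, range `R = λ v/Ω`, `λ ~ log(1/|k|)`) + near field (`nearFieldParseval_holds`,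
`DiamagneticGridBoundFrom3`): defect `≲ |k|²R³ → 0` iff `γ < 2/3`.  Large `|k|`: first-moment locality
`m₁(J^j_k) ≤ C_J L²` and `g_Ω(ω) ≤ ω/Ω²` (the right side's first term is `≥ 0` by `sectorVanishing`).
No stiffness, compressibility, gap or reflection positivity enters.  Why it might fail: only through the
exponent bookkeeping (`γ < 2/3`), which has slack — any `γ > 0` serves the assembly.
[conjecture: theory seat hubbard-h0-rotor-theory-1, cycle 8, 2026-08-28 — memo ROTOR-THEORY-8 §119; claimed THEOREM, proof at memo level] -/
def KLipschitzDeficit (Δ : ℝ) (M : ℕ → ℝ) : Prop :=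
  ∀ η > (0 : ℝ), ∃ γ : ℝ, 0 < γ ∧ γ ≤ 1 ∧ ∃ C > (0 : ℝ), ∀ᶠ L : ℕ in atTop, ∀ [NeZero L],
    ∀ a : TensorIndex (TorusSite 2 L) 2 → ℝ, IsPerronSectorGroundAmplitude L Δ (M L - 1) a →
      ∀ k : TorusSite 2 L, k ≠ 0 → ∀ ε : Fin 2 → ℂ,
        ∑ i, lorentzFilter (C * torusNorm L k ^ γ) (excitation L Δ (M L - 1) i)
            * ‖∑ j, ε j * currentAmp L Δ a k j i‖ ^ 2
          ≤ ∑ i, lorentzFilter (C * torusNorm L k ^ γ) (excitation L Δ (M L - 1) i)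
              * ‖∑ j, ε j * currentAmp L Δ a 0 j i‖ ^ 2
            + η * (L : ℝ) ^ 2 * ∑ j, ‖ε j‖ ^ 2

/-- **COMPOSITION (PROVED): continuity ∧ k-Lipschitz locality ∧ uniform helicity tensor ⇒ T-DEFICIT**
with `Υ₁ = Υ₀/2` (take `η = Υ₀/4` in `KLipschitzDeficit`, then T-JUMP). [folklore] -/
theorem filteredCurrentDeficit_of_helicity (Δ : ℝ) (M : ℕ → ℝ) (hC : ContinuityEquation)
    (hK : KLipschitzDeficit Δ M) (hU : UniformHelicityTensor Δ M) : FilteredCurrentDeficit Δ M := by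
  obtain ⟨Υ₀, hΥ₀, hUev⟩ := hU
  obtain ⟨γ, hγ, hγ1, C, hCpos, hKev⟩ := hK (Υ₀ / 4) (by positivity)
  refine ⟨γ, hγ, hγ1, C, hCpos, Υ₀ / 2, by positivity, ?_⟩
  filter_upwards [hUev, hKev, eventually_ge_atTop 3] with L hUL hKL hL3
  intro _ a ha k hk
  obtain ⟨ε, hεnorm, hD⟩ := hC L hL3 Δ k
  have hcsw : ∀ i, currentSpecWeight L Δ a k i = ‖∑ j, ε j * currentAmp L Δ a k j i‖ ^ 2 := by
    intro i
    unfold currentSpecWeight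
    rw [sum_currentAmp_eq, hD, sum_smul_mulVec]
  have hΩ : 0 < C * torusNorm L k ^ γ :=
    mul_pos hCpos (Real.rpow_pos_of_pos (torusNorm_pos hk) γ)
  have h1 := hKL a ha k hk ε
  have h2 := twistJump L Δ (M L - 1) a ha (fun j => kineticExpect L a j - Υ₀ * (L : ℝ) ^ 2) ε
    (hUL a ha ε) _ hΩ
  calc ∑ i, lorentzFilter (C * torusNorm L k ^ γ) (excitation L Δ (M L - 1) i)
          * currentSpecWeight L Δ a k i
      = ∑ i, lorentzFilter (C * torusNorm L k ^ γ) (excitation L Δ (M L - 1) i)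
          * ‖∑ j, ε j * currentAmp L Δ a k j i‖ ^ 2 := by
        refine Finset.sum_congr rfl fun i _ => ?_
        rw [hcsw i]
    _ ≤ ∑ i, lorentzFilter (C * torusNorm L k ^ γ) (excitation L Δ (M L - 1) i)
          * ‖∑ j, ε j * currentAmp L Δ a 0 j i‖ ^ 2 + Υ₀ / 4 * (L : ℝ) ^ 2 * ∑ j, ‖ε j‖ ^ 2 := h1
    _ ≤ 1 / 2 * ∑ j, ‖ε j‖ ^ 2 * (kineticExpect L a j - Υ₀ * (L : ℝ) ^ 2)
          + Υ₀ / 4 * (L : ℝ) ^ 2 * ∑ j, ‖ε j‖ ^ 2 := by linarith [h2]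
    _ = ∑ j : Fin 2, fsumWeight L k j * (kineticExpect L a j - Υ₀ / 2 * (L : ℝ) ^ 2) := by
        rw [Finset.mul_sum, Finset.mul_sum, ← Finset.sum_add_distrib]
        refine Finset.sum_congr rfl fun j _ => ?_
        rw [hεnorm j]
        ring

/-- **ASSEMBLED (PROVED) — the helicity skeleton:** f-sum rule → continuity → k-Lipschitz locality →
H1′ → uniform helicity tensor → bounded structure factor → (density, sectors) → BEC.  The stiffness
hypothesis enters only through the proved T-JUMP; the two physics stubs (`LatticeFSumRule`,
`ContinuityEquation` exact; `KLipschitzDeficit` locality) carry no hypothesis of H0. [folklore] -/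
theorem eventualCondensate_of_helicity_skeleton (Δ : ℝ) (M : ℕ → ℝ) (ρ : ℝ)
    (hρ : ρ ∈ Set.Ioo (0 : ℝ) 1)
    (hlim : Tendsto (fun L : ℕ => 1 / 2 + M L / (L : ℝ) ^ 2) atTop (𝓝 ρ))
    (hsect : ∀ᶠ L : ℕ in atTop, ∀ [NeZero L], spinZSector (Λ := TorusSite 2 L) 1 (M L - 1) ≠ ⊥)
    (hF : LatticeFSumRule Δ) (hC : ContinuityEquation) (hK : KLipschitzDeficit Δ M)
    (hG : GaussianInsertionComparison Δ M) (hU : UniformHelicityTensor Δ M)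
    (hSmax : StructureFactorUpper Δ M) : EventualCondensate Δ M := by
  have hρ0 : 0 < ρ := hρ.1
  have hρ1 : ρ < 1 := hρ.2
  have hlimM := tendsto_density_pred M ρ hlim
  have hMlo : ∀ᶠ L : ℕ in atTop, ρ / 2 ≤ 1 / 2 + (M L - 1) / (L : ℝ) ^ 2 :=
    hlimM.eventually (eventually_ge_nhds (by linarith))
  have hMhi : ∀ᶠ L : ℕ in atTop, 1 / 2 + (M L - 1) / (L : ℝ) ^ 2 ≤ (1 + ρ) / 2 :=
    hlimM.eventually (eventually_le_nhds (by linarith))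
  have hP : ∀ᶠ L : ℕ in atTop, ∀ [NeZero L],
      0 < (L : ℝ) ^ 2 / 2 + (M L - 1) ∧ (L : ℝ) ^ 2 / 2 + (M L - 1) ≤ (L : ℝ) ^ 2 := by
    filter_upwards [hMlo, hMhi] with L hlo hhi
    intro _
    have hL' : (L : ℝ) ≠ 0 := by exact_mod_cast (NeZero.ne L)
    have hL : (0 : ℝ) < (L : ℝ) ^ 2 := by positivity
    have hPM : (L : ℝ) ^ 2 / 2 + (M L - 1) = (L : ℝ) ^ 2 * (1 / 2 + (M L - 1) / (L : ℝ) ^ 2) := by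
      field_simp
    rw [hPM]
    constructor
    · have : 0 < 1 / 2 + (M L - 1) / (L : ℝ) ^ 2 := lt_of_lt_of_le (by linarith) hlo
      positivity
    · have : 1 / 2 + (M L - 1) / (L : ℝ) ^ 2 ≤ 1 := hhi.trans (by linarith)
      nlinarith
  exact eventualCondensate_of_insertionEntropyBound Δ M ρ hρ hlim
    (insertionEntropyBound_of_gaussianComparison Δ M ρ hρ hlim hG
      (infraredStructureBound_of_fsum_deficit Δ M hF
        (filteredCurrentDeficit_of_helicity Δ M hC hK hU) hP) hSmax)
    (uniformSiteDensity_holds Δ M) (perronSectorExists_of_ne_bot Δ M hsect)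


/-! ## The exact stubs discharged -/

/-- **H0 IN THE ROTOR CLASS MODULO ONE LOCALITY THEOREM:** along a density sequence `→ ρ ∈ (0,1)` with non-trivial
sectors, `KLipschitzDeficit` (k-Lipschitz locality of the filtered current kernel; THEOREM TWIST-IR's analytic
content) ∧ H1′ (Gaussian-comparable insertion entropy) ∧ (S_Υ) (uniform helicity tensor) ∧ (S ≤ S_max) ⇒ BEC —
the exact stubs T-FSUM (`latticeFSumRule_holds`) and D1 (`continuityEquation_holds`) discharged. [folklore] -/
theorem eventualCondensate_of_kLipschitz (Δ : ℝ) (M : ℕ → ℝ) (ρ : ℝ)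
    (hρ : ρ ∈ Set.Ioo (0 : ℝ) 1)
    (hlim : Tendsto (fun L : ℕ => 1 / 2 + M L / (L : ℝ) ^ 2) atTop (𝓝 ρ))
    (hsect : ∀ᶠ L : ℕ in atTop, ∀ [NeZero L], spinZSector (Λ := TorusSite 2 L) 1 (M L - 1) ≠ ⊥)
    (hK : KLipschitzDeficit Δ M) (hG : GaussianInsertionComparison Δ M) (hU : UniformHelicityTensor Δ M)
    (hSmax : StructureFactorUpper Δ M) : EventualCondensate Δ M :=
  eventualCondensate_of_helicity_skeleton Δ M ρ hρ hlim hsect (latticeFSumRule_holds Δ) continuityEquation_holds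
    hK hG hU hSmax

end Summit.HubbardSuperconductivity.HubbardSuperconductivity.Theorems.AnisotropyChord.Stiffness
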